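import Mathlib
import HarnessLib
import Literature.Barriers.HubbardSuperconductivity.WeakCouplingCeiling
import Summits.Ventures.LatticeQCDFlow.Scaling.AR1SwitchingLaw

/-!
# AR1SwitchingContinuumFloor — the thermodynamic-length × relaxation-time FLOOR holds in the AR(1)
# class with positively correlated units: `s·(1 + r^s)/(1 − r^s) ≥ 2/|log r|` for every partition
# `s` of the relaxation budget, with equality in the continuum limit `s → 0⁺`

HONEST FRAMING: exact (Metropolis-corrected) sampling algorithms for lattice gauge theory;
figures of merit are autocorrelation/cost numbers at stated couplings and volumes; no
continuum-physics claim.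

Venture `LatticeQCDFlow` (cell pub-lqcd), topic `Scaling`; FANOUT row 19 (`su2-snf`, GEN-4).
OUR WORK, elementary real analysis over `Scaling/AR1SwitchingLaw` (`kPrime Δ ρ = Δ²(1+ρ)/(1−ρ)`);
nothing is cited as a fact.  Mechanism class known (Sivak–Crooks 2012: excess work ≈ squared
thermodynamic length × relaxation time / duration; finite-time thermodynamics), here a THEOREM of
the solvable model.

THE SETTING (as in `AR1SwitchingRefinement`): elementary relaxation units of autoregression
`r ∈ (0, 1)` (positively correlated — a heat-bath-like unit; exponential autocorrelation time
`τ_exp = 1/|log r|`), a budget of `T = n_step·s` units per evolution, `s` units per protocol step so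
that the per-step coefficient is `ρ = r^s`; to leading order in `1/n_step` the model gives
`−log ESS = n_dof·k′(r^s)/n_step = (n_dof Δ²/T)·[s(1 + r^s)/(1 − r^s)]`.

* `two_mul_one_sub_exp_le` (from the tree's `sinh y ≤ y cosh y`,
  `Literature.Barriers.HubbardSuperconductivity.sinh_le_self_mul_cosh`, imported — the dedup rule)
  (`2(1 − e^{−u}) ≤ u(1 + e^{−u})`, `u ≥ 0`: `tanh(u/2) ≤ u/2`);
* **`continuumFloor_le`** — for `0 < r < 1`, `s > 0`: `2/(−log r) ≤ s·(1 + r^s)/(1 − r^s)`;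
  **`kPrime_mul_ge_continuumFloor`** — `2Δ²/(−log r) ≤ k′(r^s)·s`: NO PARTITION OF THE BUDGET BEATS
  `−log ESS ≥ 2 n_dof Δ² τ_exp / T` (leading order) — the squared thermodynamic length
  `Λ² = n_dof Δ²` times `2τ_exp` over the duration: the form of HOME/THEORY-2's conjecture C3
  (`⟨W_d⟩ ≥ ℒ²/(nγ′)`, retired for general layers because ECHO layers break it — here too: the
  floor needs `r > 0`; `AR1SwitchingEndpoints` has `⟨W⟩ = 0` at `ρ = −1`), as a theorem for
  positively autocorrelated AR(1) units;
* **`tendsto_continuumFloor`** — `s·(1 + r^s)/(1 − r^s) → 2/(−log r)` as `s → 0⁺`: the floor is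
  the continuum (infinitely fine protocol) value, approached monotonically along halvings
  (`AR1SwitchingRefinement.kPrime_refine_le`).

Reading (value-free): in the model, refining the protocol moves the cost from `k′(r)·1`
(one unit per step) down towards `2Δ²τ_exp`, never below; the total possible gain from refinement
at fixed budget is the factor `(1 + r)|log r|/(2(1 − r)) ≥ 1` (→ 1 as `r → 1`: slowly relaxing units
gain nothing from refinement; large as `r → 0`).  NOT CLAIMED: anything about lattice kernels or
about protocols that change the relaxation dynamics itself (SNF layers do).
-/

namespace Summit.Ventures.LatticeQCDFlow.Scaling

open Real Filter Topology Set

/-- The elementary inequality behind the floor: `2(1 − e^{−u}) ≤ u(1 + e^{−u})` for `u ≥ 0`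
(equivalently `tanh(u/2) ≤ u/2`). -/
theorem two_mul_one_sub_exp_le {u : ℝ} (hu : 0 ≤ u) :
    2 * (1 - Real.exp (-u)) ≤ u * (1 + Real.exp (-u)) := by
  have h := Literature.Barriers.HubbardSuperconductivity.sinh_le_self_mul_cosh (y := u / 2) (by linarith)
  rw [Real.sinh_eq, Real.cosh_eq] at h
  have hpos : 0 < Real.exp (-(u / 2)) := Real.exp_pos _
  have he : Real.exp (-u) = Real.exp (-(u / 2)) * Real.exp (-(u / 2)) := by
    rw [← Real.exp_add]; congr 1; ring
  have he1 : Real.exp (u / 2) * Real.exp (-(u / 2)) = 1 := by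
    rw [← Real.exp_add]; simp
  -- multiply `h` by `2 e^{-u/2} > 0`
  have h2 := mul_le_mul_of_nonneg_right h hpos.le
  rw [he]
  nlinarith [h2, he1, hpos]

/-- **THE CONTINUUM FLOOR of the AR(1) model.**  With elementary relaxation units of autoregression
`r ∈ (0, 1)` and `s > 0` units per protocol step (`ρ = r^s`), the leading-order cost per unit of
relaxation budget satisfies `s·(1 + r^s)/(1 − r^s) ≥ 2/(−log r)`: however finely the budget is
partitioned, `−log ESS ≳ 2 n_dof Δ²/(T·|log r|)` for a total budget `T = n_step·s` — the squared
thermodynamic length times the exponential autocorrelation time `1/|log r|` of the unit, over the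
duration (the Sivak–Crooks form, exact as a floor in this class). -/
theorem continuumFloor_le {r : ℝ} (hr0 : 0 < r) (hr1 : r < 1) {s : ℝ} (hs : 0 < s) :
    2 / (-Real.log r) ≤ s * ((1 + r ^ s) / (1 - r ^ s)) := by
  have hlog : Real.log r < 0 := Real.log_neg hr0 hr1
  have hL : 0 < -Real.log r := by linarith
  set u := -(s * Real.log r) with hu_def
  have hu : 0 < u := by rw [hu_def]; nlinarith
  have hrs : r ^ s = Real.exp (-u) := by
    rw [Real.rpow_def_of_pos hr0, hu_def, neg_neg, mul_comm]
  have hexp1 : Real.exp (-u) < 1 := by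
    rw [Real.exp_lt_one_iff]; linarith
  have hden : 0 < 1 - r ^ s := by rw [hrs]; linarith
  have key := two_mul_one_sub_exp_le hu.le
  rw [hrs]
  rw [div_le_iff₀ hL, mul_comm]
  -- goal: 2 ≤ s * ((1 + e^{-u}) / (1 - e^{-u})) * (-log r)  i.e.  2 (1 - e^{-u}) ≤ u (1 + e^{-u})
  rw [show -Real.log r * (s * ((1 + Real.exp (-u)) / (1 - Real.exp (-u))))
      = u * (1 + Real.exp (-u)) / (1 - Real.exp (-u)) by rw [hu_def]; ring]
  rw [le_div_iff₀ (by rw [hrs] at hden; exact hden)]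
  linarith

/-- The floor in the model's `k′`: `k′(r^s)·s ≥ 2Δ²/(−log r)` for every partition `s > 0` — no
refinement of the protocol beats the continuum value. -/
theorem kPrime_mul_ge_continuumFloor (Δ : ℝ) {r : ℝ} (hr0 : 0 < r) (hr1 : r < 1) {s : ℝ}
    (hs : 0 < s) : 2 * Δ ^ 2 / (-Real.log r) ≤ kPrime Δ (r ^ s) * s := by
  have h := continuumFloor_le hr0 hr1 hs
  have hΔ : 0 ≤ Δ ^ 2 := sq_nonneg Δ
  unfold kPrime
  calc 2 * Δ ^ 2 / (-Real.log r) = Δ ^ 2 * (2 / (-Real.log r)) := by ring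
    _ ≤ Δ ^ 2 * (s * ((1 + r ^ s) / (1 - r ^ s))) := mul_le_mul_of_nonneg_left h hΔ
    _ = Δ ^ 2 * ((1 + r ^ s) / (1 - r ^ s)) * s := by ring

/-- **… and the floor is the limit of ever finer protocols**: `s·(1 + r^s)/(1 − r^s) → 2/(−log r)`
as `s → 0⁺`. -/
theorem tendsto_continuumFloor {r : ℝ} (hr0 : 0 < r) (hr1 : r < 1) :
    Tendsto (fun s : ℝ => s * ((1 + r ^ s) / (1 - r ^ s))) (𝓝[>] 0) (𝓝 (2 / (-Real.log r))) := by
  have hlog : Real.log r < 0 := Real.log_neg hr0 hr1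
  -- the derivative of `s ↦ r^s` at `0` is `log r`
  have hd : HasDerivAt (fun s : ℝ => r ^ s) (Real.log r) 0 := by
    have := Real.hasStrictDerivAt_const_rpow hr0 (0 : ℝ)
    simpa using this.hasDerivAt
  have hslope : Tendsto (fun s : ℝ => s⁻¹ * (r ^ s - 1)) (𝓝[≠] 0) (𝓝 (Real.log r)) := by
    have := hd.tendsto_slope_zero
    simpa [Real.rpow_zero] using this
  have hslope' : Tendsto (fun s : ℝ => s⁻¹ * (r ^ s - 1)) (𝓝[>] 0) (𝓝 (Real.log r)) :=
    hslope.mono_left (nhdsWithin_mono _ fun x hx => ne_of_gt hx)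
  have hnum : Tendsto (fun s : ℝ => 1 + r ^ s) (𝓝[>] 0) (𝓝 2) := by
    have : Tendsto (fun s : ℝ => 1 + r ^ s) (𝓝 0) (𝓝 (1 + r ^ (0 : ℝ))) :=
      ((Real.continuousAt_const_rpow hr0.ne').const_add 1).tendsto
    rw [Real.rpow_zero, show (1 : ℝ) + 1 = 2 by norm_num] at this
    exact this.mono_left nhdsWithin_le_nhds
  -- s (1 + r^s)/(1 - r^s) = (1 + r^s) / ( - (s⁻¹ (r^s - 1)) )
  have heq : ∀ s : ℝ, s ≠ 0 → s * ((1 + r ^ s) / (1 - r ^ s)) = (1 + r ^ s) / (-(s⁻¹ * (r ^ s - 1))) := by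
    intro s hs
    by_cases h1 : r ^ s = 1
    · simp [h1]
    · have : 1 - r ^ s ≠ 0 := sub_ne_zero.mpr (Ne.symm h1)
      field_simp
      ring
  have hlim : Tendsto (fun s : ℝ => (1 + r ^ s) / (-(s⁻¹ * (r ^ s - 1)))) (𝓝[>] 0)
      (𝓝 (2 / (-Real.log r))) :=
    hnum.div hslope'.neg (by linarith)
  refine hlim.congr' ?_
  filter_upwards [self_mem_nhdsWithin] with s hs
  exact (heq s (ne_of_gt hs)).symm

end Summit.Ventures.LatticeQCDFlow.Scaling
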